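import Summits.HubbardSuperconductivity.HubbardSuperconductivity.Theorems.WidthHaldaneDefs

/-!
# Sketch — first lemmas of the crux-ideate cards (round 1, ideator k = 2) for
# `WidthHaldaneBridge` (stmt-HubbardSuperconductivity-16311)

Signatures only (every `def … : Prop`), over the landed vocabulary of
`Theorems/WidthHaldaneDefs.lean` (`tubeH0`, `tubeFilling`, `tubeStiffness`, `tubePairCompressibility`,
`tubeDWavePair`, `tubeColumnPairCorr`, `UniformThermo`, `HaldaneLawAt`) and Literature
(`expect`, `Matrix.minEnergyOn`, `szSector`, `IsGroundStateInSector`, `etaLower`, `etaRaise`).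
Nothing is proved here; the cards say which defs are provable now and which are the transferred
targets.

* Card `frustration-cost-duality`: `columnJosephson`, `FrustrationCostEngine` (first lemma),
  `ColumnJosephsonExpect`, `FrustrationCostLaw` / `FrustrationCostBridge` (transfer target C⁺),
  `LowEnergyWindowLaw` (C⁺⁺), `FeshbachStep`, `FrustrationCostReduction`.
* Card `bochner-majority-split`: `tubePairField`, `BochnerFloor` (first lemma), `WideMajority`,
  `LawAtLM`, `ThinLaw`, `WideThinBridge`, `WideThinReduction`.
* Card `eta-lowest-weight`: `tubeStagger`, `EtaLowestWeight` (first lemma),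
  `staggeredColumnCurrent`, `ColumnPairTriplet`, `PairCorrAsRaisedCurrent`.
-/

noncomputable section

namespace Summit.HubbardSuperconductivity.HubbardSuperconductivity.Cruxes.WidthHaldaneBridge.IdeaSketchK2

set_option linter.dupNamespace false

open scoped BigOperators Classical Matrix ComplexConjugate
open Matrix Literature.MathematicalPhysics.QuantumLattice
open Summit.HubbardSuperconductivity.HubbardSuperconductivity.Theorems.WidthHaldane
open Summit.HubbardSuperconductivity.HubbardSuperconductivity.Theses.WidthHaldane (WidthHaldaneBridge)

/-! ## Shared objects -/

/-- The column `d_{x²-y²}` pair field `Φ_a = Σ_b P_{e⁻¹(a,b)}` (the inner sum of `tubeColumnPairCorr`). -/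
def columnPair (L M : ℕ) [NeZero L] [NeZero M] (Λ : Type) [LinearOrder Λ] [Fintype Λ] (e : Λ ≃ ZMod L × ZMod M)
    (a : ZMod L) : Matrix (Finset (Orb Λ)) (Finset (Orb Λ)) ℂ :=
  ∑ b : ZMod M, tubeDWavePair L M Λ e (e.symm (a, b))

/-- The total tube pair field `Δ = Σ_a Φ_a` (so that `Σ_r G_ψ(r) = ‖Δ ψ‖²`). -/
def tubePairField (L M : ℕ) [NeZero L] [NeZero M] (Λ : Type) [LinearOrder Λ] [Fintype Λ] (e : Λ ≃ ZMod L × ZMod M) :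
    Matrix (Finset (Orb Λ)) (Finset (Orb Λ)) ℂ :=
  ∑ a : ZMod L, columnPair L M Λ e a

/-- The exponent `x_{L,M} = Ξ √(ẽ″_{L,M}/ρ̃_{L,M}) / M` of the crux's law. -/
def lawExponent (L M : ℕ) [NeZero L] [NeZero M] (Λ : Type) [LinearOrder Λ] [Fintype Λ]
    (e : Λ ≃ ZMod L × ZMod M) (U δ Ξ : ℝ) : ℝ :=
  Ξ * Real.sqrt (tubePairCompressibility L M Λ e U δ / tubeStiffness L M Λ e U δ) / (M : ℝ)

/-- The crux's law at ONE pair `(L, M)` with constants `(Ξ, A, R)` (verbatim slice of `HaldaneLawAt`). -/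
def LawAtLM (U δ : ℝ) (L M : ℕ) [NeZero L] [NeZero M] (Ξ A : ℝ) (R : ℕ) : Prop :=
  ∀ (Λ : Type) [LinearOrder Λ] [Fintype Λ] (e : Λ ≃ ZMod L × ZMod M) (ψ : Fock (Orb Λ)),
    star ψ ⬝ᵥ ψ = 1 → IsGroundStateInSector (tubeH0 L M Λ e U) (tubeFilling L M δ) 0 ψ →
      ∀ r : ZMod L, R ≤ r.val → r.val + R ≤ L →
        A * (L : ℝ) * (M : ℝ) ^ 2 * ((min r.val (L - r.val) : ℕ) : ℝ) ^ (-(lawExponent L M Λ e U δ Ξ)) ≤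
          tubeColumnPairCorr L M Λ e ψ r

/-! ## Card `frustration-cost-duality` -/

/-- The FRUSTRATING column Josephson coupling at displacement `r`:
`J_r = ½ Σ_a (Φ_a† Φ_{a+r} + Φ_{a+r}† Φ_a)` (Hermitian, conserves `N` and `S^z`). -/
def columnJosephson (L M : ℕ) [NeZero L] [NeZero M] (Λ : Type) [LinearOrder Λ] [Fintype Λ] (e : Λ ≃ ZMod L × ZMod M)
    (r : ZMod L) : Matrix (Finset (Orb Λ)) (Finset (Orb Λ)) ℂ :=
  (1 / 2 : ℂ) • ∑ a : ZMod L, ((columnPair L M Λ e a)ᴴ * columnPair L M Λ e (a + r) +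
    (columnPair L M Λ e (a + r))ᴴ * columnPair L M Λ e a)

/-- FIRST LEMMA (the engine; provable now from `minEnergyOn_le_rayleigh_of_mem`): for EVERY matrix `V`,
every `ν > 0` and every normalised sector ground state `ψ` of the tube,
`E_N(H₀ + νV) - E_N(H₀) ≤ ν · Re⟨ψ, V ψ⟩` — an energy FLOOR for the perturbed tube is a floor on
`⟨V⟩` in every ground state at once. -/
def FrustrationCostEngine : Prop :=
  ∀ (L M : ℕ) [NeZero L] [NeZero M] (Λ : Type) [LinearOrder Λ] [Fintype Λ] (e : Λ ≃ ZMod L × ZMod M)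
    (U : ℝ) (N : ℕ) (V : Matrix (Finset (Orb Λ)) (Finset (Orb Λ)) ℂ) (ν : ℝ), 0 < ν →
    ∀ ψ : Fock (Orb Λ), star ψ ⬝ᵥ ψ = 1 → IsGroundStateInSector (tubeH0 L M Λ e U) N 0 ψ →
      (tubeH0 L M Λ e U + (ν : ℂ) • V).minEnergyOn (szSector N 0) -
          (tubeH0 L M Λ e U).minEnergyOn (szSector N 0) ≤ ν * (expect V ψ).re

/-- Kinematic identity (provable now): `Re⟨ψ, J_r ψ⟩ = G_ψ(r)`. -/
def ColumnJosephsonExpect : Prop :=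
  ∀ (L M : ℕ) [NeZero L] [NeZero M] (Λ : Type) [LinearOrder Λ] [Fintype Λ] (e : Λ ≃ ZMod L × ZMod M)
    (ψ : Fock (Orb Λ)) (r : ZMod L),
    (expect (columnJosephson L M Λ e r) ψ).re = tubeColumnPairCorr L M Λ e ψ r

/-- TRANSFER TARGET C⁺ at `(U, δ)` with constants `(Ξ, A, R, M₂, L₁)`: the FRUSTRATION-COST LAW —
for every admissible tube and displacement there is a coupling `ν > 0` at which the frustrating
column Josephson term raises the sector ground energy by at least `ν · A·L·M²·r̂^{-x_{L,M}}`.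
Only sector MINIMA of explicit Hermitian matrices occur (no eigenvector, no "every ground state"). -/
def FrustrationCostLaw (U δ Ξ A : ℝ) (R M₂ L₁ : ℕ) : Prop :=
  ∀ (L M : ℕ) [NeZero L] [NeZero M], Even L → Even M → M₂ ≤ M → M ≤ L → L₁ ≤ L →
    ∀ (Λ : Type) [LinearOrder Λ] [Fintype Λ] (e : Λ ≃ ZMod L × ZMod M) (r : ZMod L),
      R ≤ r.val → r.val + R ≤ L →
        ∃ ν : ℝ, 0 < ν ∧
          ν * (A * (L : ℝ) * (M : ℝ) ^ 2 * ((min r.val (L - r.val) : ℕ) : ℝ) ^ (-(lawExponent L M Λ e U δ Ξ))) ≤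
            (tubeH0 L M Λ e U + (ν : ℂ) • columnJosephson L M Λ e r).minEnergyOn (szSector (tubeFilling L M δ) 0) -
              (tubeH0 L M Λ e U).minEnergyOn (szSector (tubeFilling L M δ) 0)

/-- C⁺ as a bridge: `UniformThermo ⇒ FrustrationCostLaw` (same quantifier shell as the crux). -/
def FrustrationCostBridge : Prop :=
  ∀ U : ℝ, 0 < U → ∀ δ ∈ Set.Ioo (0 : ℝ) (3 / 10), ∀ (d₀ k₀ : ℝ) (M₁ L₀ : ℕ), 0 < d₀ →
    UniformThermo U δ d₀ k₀ M₁ L₀ →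
      ∃ Ξ : ℝ, 0 < Ξ ∧ ∃ A : ℝ, 0 < A ∧ ∃ R M₂ L₁ : ℕ, FrustrationCostLaw U δ Ξ A R M₂ L₁

/-- The composition a crux-plan seat kernel-checks (engine + identity, two lines):
`FrustrationCostEngine → ColumnJosephsonExpect → FrustrationCostBridge → WidthHaldaneBridge`. -/
def FrustrationCostReduction : Prop :=
  FrustrationCostEngine → ColumnJosephsonExpect → FrustrationCostBridge → WidthHaldaneBridge

/-- C⁺⁺, the LOW-ENERGY-WINDOW LAW (effective-Hamiltonian form): the frustrating Josephson coupling
has expectation `≥ A·L·M²·r̂^{-x}` in EVERY normalised sector state of excitation energy `≤ Ω(L,M,r)`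
(not only in ground states). With `Ω` below the sector gap it is the crux's law; the physical window
is extensive, `Ω ≍ ρ̃·L·M/r̂²` (phase slips). -/
def LowEnergyWindowLaw (U δ Ξ A : ℝ) (R M₂ L₁ : ℕ) (Ω : ℕ → ℕ → ℕ → ℝ) : Prop :=
  ∀ (L M : ℕ) [NeZero L] [NeZero M], Even L → Even M → M₂ ≤ M → M ≤ L → L₁ ≤ L →
    ∀ (Λ : Type) [LinearOrder Λ] [Fintype Λ] (e : Λ ≃ ZMod L × ZMod M) (r : ZMod L),
      R ≤ r.val → r.val + R ≤ L →
        ∀ φ : Fock (Orb Λ), φ ∈ szSector (tubeFilling L M δ) 0 → star φ ⬝ᵥ φ = 1 →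
          (expect (tubeH0 L M Λ e U) φ).re ≤
              (tubeH0 L M Λ e U).minEnergyOn (szSector (tubeFilling L M δ) 0) + Ω L M r.val →
            A * (L : ℝ) * (M : ℝ) ^ 2 * ((min r.val (L - r.val) : ℕ) : ℝ) ^ (-(lawExponent L M Λ e U δ Ξ)) ≤
              (expect (columnJosephson L M Λ e r) φ).re

/-- FESHBACH STEP (provable linear algebra, min–max with the spectral projection `P_{≤Ω}` and the
landed kinematic ceiling `‖J_r‖ ≤ 32·L·M²`): a window law with `Ω > 0` gives the cost law with half
the amplitude (at `ν = Ω/(8·(32LM²)²)`). -/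
def FeshbachStep : Prop :=
  ∀ (U δ Ξ A : ℝ) (R M₂ L₁ : ℕ) (Ω : ℕ → ℕ → ℕ → ℝ), (∀ L M r, 0 < Ω L M r) →
    LowEnergyWindowLaw U δ Ξ A R M₂ L₁ Ω → FrustrationCostLaw U δ Ξ (A / 2) R M₂ L₁

/-! ## Card `bochner-majority-split` -/

/-- FIRST LEMMA (kinematic, provable now; Bochner on `ℤ/L`): the column correlator is positive
definite (`Ĝ_ψ(k) = ‖Σ_a e^{-ika} Φ_a ψ‖² ≥ 0`), hence for EVERY vector `ψ` and every `r`: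
`G_ψ(r) ≥ 2‖Δψ‖²/L - G_ψ(0)` (`Δ = Σ_a Φ_a`, `‖Δψ‖² = Ĝ_ψ(0) = Σ_r G_ψ(r)`). -/
def BochnerFloor : Prop :=
  ∀ (L M : ℕ) [NeZero L] [NeZero M] (Λ : Type) [LinearOrder Λ] [Fintype Λ] (e : Λ ≃ ZMod L × ZMod M)
    (ψ : Fock (Orb Λ)) (r : ZMod L),
    2 * (expect ((tubePairField L M Λ e)ᴴ * tubePairField L M Λ e) ψ).re / (L : ℝ) -
        tubeColumnPairCorr L M Λ e ψ 0 ≤ tubeColumnPairCorr L M Λ e ψ r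

/-- WIDE piece (`c·log L ≤ M`): tube pair "LRO" `‖Δψ‖² ≥ A·L²·M²` AND `k = 0` MAJORITY
`‖Δψ‖² ≥ (1+ε)/2 · L · G_ψ(0)` (more than half of the column sum rule `Σ_k Ĝ(k) = L·G(0)` sits at
zero momentum) — two scalar inequalities per ground state, no exponent, no displacement. -/
def WideMajority (U δ c ε A : ℝ) (M₂ L₁ : ℕ) : Prop :=
  ∀ (L M : ℕ) [NeZero L] [NeZero M], Even L → Even M → M₂ ≤ M → M ≤ L → L₁ ≤ L →
    c * Real.log (L : ℝ) ≤ (M : ℝ) →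
      ∀ (Λ : Type) [LinearOrder Λ] [Fintype Λ] (e : Λ ≃ ZMod L × ZMod M) (ψ : Fock (Orb Λ)),
        star ψ ⬝ᵥ ψ = 1 → IsGroundStateInSector (tubeH0 L M Λ e U) (tubeFilling L M δ) 0 ψ →
          A * (L : ℝ) ^ 2 * (M : ℝ) ^ 2 ≤ (expect ((tubePairField L M Λ e)ᴴ * tubePairField L M Λ e) ψ).re ∧
            (1 + ε) / 2 * ((L : ℝ) * tubeColumnPairCorr L M Λ e ψ 0) ≤
              (expect ((tubePairField L M Λ e)ᴴ * tubePairField L M Λ e) ψ).re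

/-- THIN piece (`M < c·log L`, i.e. `L > e^{M/c}`): the crux's law verbatim, but ONLY for lengths
exponentially large in the width — per-width Luther–Emery asymptotics with thresholds `L_M ≤ e^{M/c}`
suffice here. -/
def ThinLaw (U δ c Ξ A : ℝ) (R M₂ L₁ : ℕ) : Prop :=
  ∀ (L M : ℕ) [NeZero L] [NeZero M], Even L → Even M → M₂ ≤ M → M ≤ L → L₁ ≤ L →
    (M : ℝ) < c * Real.log (L : ℝ) → LawAtLM U δ L M Ξ A R

/-- TRANSFER TARGET of the card: `UniformThermo ⇒ (wide majority) ∧ (thin law)`. -/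
def WideThinBridge : Prop :=
  ∀ U : ℝ, 0 < U → ∀ δ ∈ Set.Ioo (0 : ℝ) (3 / 10), ∀ (d₀ k₀ : ℝ) (M₁ L₀ : ℕ), 0 < d₀ →
    UniformThermo U δ d₀ k₀ M₁ L₀ →
      ∃ c : ℝ, 0 < c ∧ ∃ ε : ℝ, 0 < ε ∧ ∃ Ξ : ℝ, 0 < Ξ ∧ ∃ A : ℝ, 0 < A ∧ ∃ R M₂ L₁ : ℕ,
        1 ≤ R ∧ WideMajority U δ c ε A M₂ L₁ ∧ ThinLaw U δ c Ξ A R M₂ L₁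

/-- The composition a crux-plan seat kernel-checks: wide ⇒ `G(r) ≥ ε/(1+ε)·2‖Δψ‖²/L ≥ εA·L·M² ≥
εA·L·M²·r̂^{-x}` (Bochner floor, `r̂ ≥ 1`, `x ≥ 0`); thin ⇒ verbatim; constants `min`/`max`. -/
def WideThinReduction : Prop :=
  BochnerFloor → WideThinBridge → WidthHaldaneBridge

/-! ## Card `eta-lowest-weight` -/

/-- The bipartite stagger `ε_x = (-1)^{a+b}` of the even tube, `e x = (a, b)`. -/
def tubeStagger (L M : ℕ) (Λ : Type) (e : Λ ≃ ZMod L × ZMod M) (x : Λ) : ℤˣ :=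
  (-1) ^ ((e x).1.val + (e x).2.val)

/-- FIRST LEMMA (provable now from Yang's commutator `hamiltonian_commutator_etaRaise`, the `η`–`su(2)`
relations and the variational principle): STRICT pair convexity `0 < ẽ″_{L,M}` — one clause of
`UniformThermo` — forces every sector ground state at the crux's filling to be an `η`-LOWEST-WEIGHT
vector, `η_ε ψ = 0` (pseudospin `J = |J_z| = (LM - N)/2` exactly). -/
def EtaLowestWeight : Prop :=
  ∀ (L M : ℕ) [NeZero L] [NeZero M], Even L → Even M →
    ∀ (Λ : Type) [LinearOrder Λ] [Fintype Λ] (e : Λ ≃ ZMod L × ZMod M) (U δ : ℝ),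
      0 < δ → δ < 1 → 2 ≤ tubeFilling L M δ → 0 < tubePairCompressibility L M Λ e U δ →
        ∀ ψ : Fock (Orb Λ), IsGroundStateInSector (tubeH0 L M Λ e U) (tubeFilling L M δ) 0 ψ →
          etaLower (tubeStagger L M Λ e) *ᵥ ψ = 0

/-- The staggered column `d`-current `K_a := [η_ε, Φ_a†]` — the `m = 0` member of the pseudospin
triplet `(Φ_a†, K_a, Φ_a)`; it is the `d`-density-wave (staggered-flux) order operator of column `a`. -/
def staggeredColumnCurrent (L M : ℕ) [NeZero L] [NeZero M] (Λ : Type) [LinearOrder Λ] [Fintype Λ]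
    (e : Λ ≃ ZMod L × ZMod M) (a : ZMod L) : Matrix (Finset (Orb Λ)) (Finset (Orb Λ)) ℂ :=
  etaLower (tubeStagger L M Λ e) * (columnPair L M Λ e a)ᴴ -
    (columnPair L M Λ e a)ᴴ * etaLower (tubeStagger L M Λ e)

/-- TRIPLET CLOSURE (operator identities, provable now; even `L`, `M`):
`[η_ε, K_a] = 2 Φ_a` and `[η_ε†, Φ_a†] = 0`. -/
def ColumnPairTriplet : Prop :=
  ∀ (L M : ℕ) [NeZero L] [NeZero M], Even L → Even M →
    ∀ (Λ : Type) [LinearOrder Λ] [Fintype Λ] (e : Λ ≃ ZMod L × ZMod M) (a : ZMod L),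
      etaLower (tubeStagger L M Λ e) * staggeredColumnCurrent L M Λ e a -
          staggeredColumnCurrent L M Λ e a * etaLower (tubeStagger L M Λ e) =
        (2 : ℂ) • columnPair L M Λ e a ∧
      etaRaise (tubeStagger L M Λ e) * (columnPair L M Λ e a)ᴴ -
          (columnPair L M Λ e a)ᴴ * etaRaise (tubeStagger L M Λ e) = 0

/-- IDENTITY under lowest weight (two lines from `ColumnPairTriplet`): for `η ψ = 0`,
`⟨Φ_a ψ, Φ_b ψ⟩ = ¼ ⟨η K_a ψ, η K_b ψ⟩` — the `d`-wave pair correlator of an `η`-lowest-weight state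
is the `η`-RAISED part of its staggered `d`-current correlator (and then, by `H η† = η† (H + U)`,
a spectrally shifted current–current response). -/
def PairCorrAsRaisedCurrent : Prop :=
  ∀ (L M : ℕ) [NeZero L] [NeZero M], Even L → Even M →
    ∀ (Λ : Type) [LinearOrder Λ] [Fintype Λ] (e : Λ ≃ ZMod L × ZMod M) (ψ : Fock (Orb Λ)) (a b : ZMod L),
      etaLower (tubeStagger L M Λ e) *ᵥ ψ = 0 →
        star (columnPair L M Λ e a *ᵥ ψ) ⬝ᵥ (columnPair L M Λ e b *ᵥ ψ) =
          (1 / 4 : ℂ) * (star ((etaLower (tubeStagger L M Λ e) * staggeredColumnCurrent L M Λ e a) *ᵥ ψ) ⬝ᵥ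
            ((etaLower (tubeStagger L M Λ e) * staggeredColumnCurrent L M Λ e b) *ᵥ ψ))

end Summit.HubbardSuperconductivity.HubbardSuperconductivity.Cruxes.WidthHaldaneBridge.IdeaSketchK2

end
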